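import Literature.MathematicalPhysics.QuantumFieldTheory.Balaban1983to89.B5Eq112TorusCarriers
import Literature.MathematicalPhysics.QuantumFieldTheory.Balaban1983to89.B5Eq147Landau
import Literature.MathematicalPhysics.QuantumFieldTheory.Balaban1983to89.B5TowerOneStroke
import Literature.MathematicalPhysics.QuantumFieldTheory.Balaban1983to89.B5Eq118OneStroke
import Literature.MathematicalPhysics.QuantumFieldTheory.Balaban1983to89.B5Eq117CompositionV1
import Literature.MathematicalPhysics.QuantumFieldTheory.Balaban1983to89.B5HierAxialGaugeV1

/-!
# `Balaban1983to89.B5Eq117TorusCarriers` — T. Bałaban, *Propagators and renormalization transformations for lattice gauge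
theories. I*, Commun. Math. Phys. **95** (1984) 17–40 [Balaban1984PropagatorsI], Sect. B p. 20, (1.17)–(1.20): ONE tower of lattices,
TWO formalizations — the finest-level carrier identification `T^{(0)} ≃` (level `k` of the B5 tower over `T^{(k)}`), the dictionaries
for the composites `Q_k` (1.18), `Q′_k` (1.20), the gradient (1.4) and the action `S^η` (1.3)/(1.17), and the hierarchical block-axial
gauge of V1 as a complete gauge fixing of the residual group `N(Q′_k)` (file 1 of the (1.17) knitting; file 2 = `B5Eq117TorusBridge`)

statement-level skeleton of published theorems with citation tags; proofs where landed; nothing here is a claim about the Yang–Mills mass gap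

PDF held: `paper:balaban1984-cmp95-propagators-rt-i` (journal page = PDF page + 16); pp. 18–21 [PDF 2–5] read from the materialised text
`~/.lit/texts/paper-balaban1984-cmp95-propagators-rt-i/p0002.txt … p0005.txt` (and the ×2 page renders under
`run/shared/lean/pub/pub-balaban/b2b-balaban-ref1/pages/1984-cmp95-propagators-rt-I/`).

PRINT, verbatim.  p. 20 [PDF 4]: *"It is easily seen that a composition of k transformations is given by ((ST)^k e^{−S})(B) =
z^{(k)} ∫dA δ(B − Q_kA) δ_Ax(Q_{k−1}A)·…·δ_Ax(A) e^{−S^η(A)}, (1.17) where z^{(k)} is a numerical factor arising from scaling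
transformations, (Q_kA)_b = Σ_{x∈B^k(b₋)} η^{d+1}A([x, x(b)]), b ⊂ T₁^{(k)}, (1.18) … or denoting (Q′_kλ)(y) = Σ_{x∈B^k(y)} η^dλ(x), we
have Q_kA^λ = Q_kA − ∂Q′_kλ. (1.20)  The δ-function δ(B − Q_kA) is invariant with respect to gauge transformations λ satisfying
Q′_kλ = 0 and we can look at the integral (1.17) as obtained by removing this gauge freedom by the help of the δ-functions δ_Ax."*

CITATION HEADER (lean-in-tree rule) — WHAT IS REPRODUCED.  SKELETON rows `B5.Eq1.17` (fold owner r02: «proved p245722 (`eq117_holds`,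
tower) · V1 twin proved p248231/p248412 (p38 `B5Eq117CompositionV1.eq117`)»), `B5.Eq1.18`, `B5.Eq1.20`, and `C1.Eq4.1.3-4.1.5` (p09's
`torusZax`, knitted to V1 by p38's `B5Eq117FibreVolume`): KNITTING of the two towers, FILE 1 of 2.  The two vocabularies: V1 (finest
lattice `Site P 0`, unit lattice `Site P k`; `bondAvgIter k` = Q_k, `siteAvgIter k` = Q′_k, `grad`, `curlAction`, the hierarchical
CENTRED block-axial support `BIJ85AxialPropagator411.deltaAx k` of `δ_Ax(Q_{k−1}A)⋯δ_Ax(A)`) and the B5 owner's tower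
(`B5SectBStatements.towerM L M k` over the unit lattice `Tor M`, composites `Qk`, `Qsk`, `AxAll k` with CORNER trees, `actionEta k`;
one-stroke identification `B5TowerOneStroke.towerE`/`cplx_Qk`/`cplxS_Qsk` of seat p21; residual orbit `B5Eq147Landau.orbit k = ∂N(Q′_k)`).
WHAT IS PROVED (kernel, no `sorry`, standard axioms; standing range `k ≤ m + K`):
* §0 `eK : Site P 0 ≃ Tor (towerM L (Mk P k) k)` (`Mk P k = const (sitesPerDir k)`, `Site P k` IS `Tor (Mk P k)`; a `recast` along
  `sitesPerDir 0 = L^k·sitesPerDir k`), its one-stroke reading `EK = towerE ∘ eK : Site P 0 ≃ Tor (fine (L^k) Mk)`, the blocks of order `k`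
  `blockEquivK : {0,…,L^k−1}^d ≃ B^k(y)` (p39's `B5Eq118OneStroke.iterBlock`) with `EK (blockSiteK y j + t e_μ) = bpt y j + tstep μ t`,
  transports `tV`/`tS`/`tB`/`tSc`;
* §1 DICTIONARIES **(1.18) `Qk_tV : Qk L Mk k (tV A) = tB (bondAvgIter k A)`** (p21's `cplx_Qk` ∘ p39's `bondAvgIter_eq_blockSum`),
  **(1.20) `Qsk_tS : Qsk L Mk k (tS λ) = tSc (siteAvgIter k λ)`**, (1.4) `tV_grad`, (1.3)/(1.17) `actionS_tV`, `actionEta_tV :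
  actionEta L Mk k (tV A) = curlAction (η^d) (L^k) A` (`η = L^{−k}`);
* §2 «we can look at the integral (1.17) as obtained by removing this gauge freedom by the help of the δ-functions δ_Ax»:
  `isCompl_axialAllV1_orbitV1K` — `VecField P 0 = {δ_{k,Ax}} ⊕ ∂N(Q′_k)` on V1 (p37's `B5HierAxialGaugeV1.hierAxial_exists` /
  `kernel_trivial`); `map_tV_orbitV1K` — the transported V1 orbit IS `B5Eq147Landau.orbit L Mk k`; hence `isCompl_axTK_orbit` — the
  transported hierarchical CENTRED-axial subspace `axTK` is a second slice of the tower's residual orbit (the first being `AxAll k`,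
  `B5Eq147Landau.isCompl_axAll_orbit`).
HONEST SCOPE.  `axTK ≠ AxAll k` in general (centred vs corner block trees at every level); U = 1, real (abelian) fields, every `d ≥ 1`,
odd `L > 1`.  No new definition of a printed object: only transports/reindexings and the two subspaces `{δ_{k,Ax}}`, `∂N(Q′_k)` of V1
as named submodules; no `def … : Prop`, nothing is a named unproved fact.

Unit `lit-balaban-p16` gen 3 (Phase-2 proof seat p16; literature-prover-lit-balaban-p16-g3-0), HOME `run/shared/lean/pub/lit-balaban/`
(STATUS: `lit-balaban-p16/STATUS.md`), 2026-08-21.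
-/

open scoped BigOperators Matrix

namespace Literature.MathematicalPhysics.QuantumFieldTheory.Balaban1983to89

namespace B5Eq117TorusCarriers

open LatticeFieldCalculus B5SectBStatements B5Eq112TorusCarriers
open B5Prop11Plancherel (Tor fine unitVec)
open B5Block118 (bpt tstep)
open B5Composition116 (recast recast_apply recast_add recast_natCast recast_tstep)
open B5TowerOneStroke (towerE towerM_eq_fine trC trC_apply' recast_recast cplx_Qk cplxS_Qsk)
open B5Eq118OneStroke (iterBlock iterBlockOf mem_iterBlock_iff bondAvgIter_eq_blockSum siteAvgIter_eq_blockSum)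
open B5Eq112RenormTransf
open B5Eq117CompositionV1 (multiRT kerBasisIter kerDimIter isBasisOf_kerBasisIter faceFieldIter bondAvgIter_faceFieldIter
  deltaAx_faceFieldIter)
open Literature.MathematicalPhysics.QuantumFieldTheory.BalabanImbrieJaffe1984to88.BIJ85AxialPropagator411
  (isAxial_add isAxial_smul isAxial_zero deltaAx constraint411 mem_constraint411 bondAvgIter_add bondAvgIter_smul
    bondAvgIter_map_zero)
open Literature.MathematicalPhysics.QuantumFieldTheory.BalabanImbrieJaffe1984to88.BIJ85GaugeFunction5113
  (grad_add grad_smul grad_mul siteAvgIter_add siteAvgIter_smul)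

noncomputable section

variable {P : Params} {k : ℕ}

/-! ## §0  The finest-level carrier over `k` levels: `T^{(0)}` of `Setup` IS level `k` of the tower over `T^{(k)}` -/

/-- the periods of the unit lattice `T₁^{(k)}` (= `T^{(k)}` of `Setup`): `Site P k` IS `Tor (Mk P k)`, and level `k` of the B5 tower
over it has the periods `L^k·sitesPerDir k = sitesPerDir 0` of the finest lattice `T^{(0)}` = `T_η`. [cite: Balaban1984PropagatorsI, (1.17) p.20] -/
abbrev Mk (P : Params) (k : ℕ) : Fin P.d → ℕ := fun _ => P.sitesPerDir k

/-- `|T^{(0)}| = L^k·|T^{(k)}|` per direction (standing range). [cite: Balaban1984PropagatorsI, (1.18) p.20] -/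
theorem sitesPerDir_zero_eq (hk : k ≤ P.m + P.K) : P.sitesPerDir 0 = P.L ^ k * P.sitesPerDir k := by
  unfold Params.sitesPerDir
  have h : P.m + P.K - 0 = k + (P.m + P.K - k) := by omega
  rw [h, pow_add]
  ring

/-- the periods of `T^{(0)}` are those of level `k` of the tower over `Mk`. [cite: Balaban1984PropagatorsI, (1.17) p.20] -/
theorem sitesPerDir_zero_eq_towerM (hk : k ≤ P.m + P.K) (ν : Fin P.d) :
    (fun _ : Fin P.d => P.sitesPerDir 0) ν = towerM P.L (Mk P k) k ν := by
  rw [towerM_eq_fine]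
  exact sitesPerDir_zero_eq hk

/-- **THE FINEST-LEVEL CARRIER IDENTIFICATION** `T^{(0)} ≃` level `k` of the B5 tower over `T₁^{(k)}` (`B5Composition116.recast`,
componentwise `ZMod.ringEquivCongr`; labels, sums and unit steps preserved). [cite: Balaban1984PropagatorsI, (1.17) p.20] -/
def eK (hk : k ≤ P.m + P.K) : Site P 0 ≃ Tor (towerM P.L (Mk P k) k) :=
  recast (N := fun _ : Fin P.d => P.sitesPerDir 0) (sitesPerDir_zero_eq_towerM hk)

/-- `eK` acts componentwise. [cite: Balaban1984PropagatorsI, (1.17) p.20] -/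
theorem eK_apply (hk : k ≤ P.m + P.K) (x : Site P 0) (ν : Fin P.d) :
    eK hk x ν = ZMod.ringEquivCongr (sitesPerDir_zero_eq_towerM hk ν) (x ν) := rfl

/-- `eK (x + e_μ) = eK x + e_μ` (bonds go to bonds). [cite: Balaban1984PropagatorsI, (1.1) p.18] -/
theorem eK_shift (hk : k ≤ P.m + P.K) (x : Site P 0) (μ : Fin P.d) :
    eK hk (x.shift μ) = eK hk x + unitVec (towerM P.L (Mk P k) k) μ := by
  funext ν
  simp only [eK_apply, Pi.add_apply, unitVec, Site.shift]
  by_cases hν : ν = μ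
  · subst hν
    rw [Function.update_self, Pi.single_eq_same, map_add, map_one]
  · rw [Function.update_of_ne hν, Pi.single_eq_of_ne hν, add_zero]

/-- the ONE-STROKE reading of the same identification, `T^{(0)} ≃ Tor (L^k·Mk)` (composite with p21's `B5TowerOneStroke.towerE`), in which
the blocks of order `k` «B^k(y)» of (1.18) are `{L^k·y + j}`. [cite: Balaban1984PropagatorsI, (1.18) p.20] -/
def EK (hk : k ≤ P.m + P.K) : Site P 0 ≃ Tor (fine (P.L ^ k) (Mk P k)) := (eK hk).trans (towerE P.L (Mk P k) k)

/-- `EK` acts componentwise (one `ringEquivCongr` along the composite equality of periods). [cite: Balaban1984PropagatorsI, (1.18) p.20] -/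
theorem EK_apply (hk : k ≤ P.m + P.K) (x : Site P 0) (ν : Fin P.d) :
    EK hk x ν = ZMod.ringEquivCongr ((sitesPerDir_zero_eq_towerM hk ν).trans (towerM_eq_fine P.L (Mk P k) k ν)) (x ν) := by
  show ZMod.ringEquivCongr _ (ZMod.ringEquivCongr _ (x ν)) = _
  exact ZMod.ringEquivCongr_ringEquivCongr_apply _ _ _

/-- `EK` fixes natural-number label vectors. [cite: Balaban1984PropagatorsI, (1.18) p.20] -/
theorem EK_natCast (hk : k ≤ P.m + P.K) (c : Fin P.d → ℕ) :
    EK hk (fun ν => ((c ν : ℕ) : ZMod (P.sitesPerDir 0))) = fun ν => ((c ν : ℕ) : ZMod (fine (P.L ^ k) (Mk P k) ν)) := by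
  funext ν
  rw [EK_apply, map_natCast]

/-- the point of offset `j ∈ {0,…,L^k−1}^d` of the block of order `k` over `y`, «x ∈ B^k(y)», labels `L^k·y + j`.
[cite: Balaban1984PropagatorsI, (1.18) p.20] -/
def blockSiteK (k : ℕ) (y : Site P k) (j : Fin P.d → Fin (P.L ^ k)) : Site P 0 :=
  fun ν => (((y ν).val * P.L ^ k + j ν : ℕ) : ZMod (P.sitesPerDir 0))

/-- labels of the block points (no wrap-around in the standing range). [cite: Balaban1984PropagatorsI, (1.18) p.20] -/
theorem val_blockSiteK (hk : k ≤ P.m + P.K) (y : Site P k) (j : Fin P.d → Fin (P.L ^ k)) (ν : Fin P.d) :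
    ((blockSiteK k y j) ν).val = (y ν).val * P.L ^ k + j ν := by
  simp only [blockSiteK]
  rw [ZMod.val_natCast, Nat.mod_eq_of_lt]
  have hy : (y ν).val + 1 ≤ P.sitesPerDir k := ZMod.val_lt (y ν)
  have h1 : ((y ν).val + 1) * P.L ^ k ≤ P.sitesPerDir k * P.L ^ k := Nat.mul_le_mul_right _ hy
  have h2 := (j ν).isLt
  rw [sitesPerDir_zero_eq hk, mul_comm (P.L ^ k) (P.sitesPerDir k)]
  rw [Nat.add_mul, one_mul] at h1
  omega

/-- `L^k·y + j ∈ B^k(y)` (p39's `iterBlock`). [cite: Balaban1984PropagatorsI, (1.18) p.20] -/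
theorem blockSiteK_mem_iterBlock (hk : k ≤ P.m + P.K) (y : Site P k) (j : Fin P.d → Fin (P.L ^ k)) :
    blockSiteK k y j ∈ iterBlock k y := by
  rw [mem_iterBlock_iff hk]
  intro μ
  have hL : 0 < P.L ^ k := pow_pos P.L_pos k
  rw [val_blockSiteK hk, mul_comm, Nat.mul_add_div hL, Nat.div_eq_of_lt (j μ).isLt, add_zero]

/-- **`B^k(y) ≃ {0,…,L^k−1}^d`**: the block of order `k` (p39's `B5Eq118OneStroke.iterBlock`, the `L^{kd}` finest sites over `y`) is
parametrised by the offsets. [cite: Balaban1984PropagatorsI, (1.18) p.20] -/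
def blockEquivK (hk : k ≤ P.m + P.K) (y : Site P k) : (Fin P.d → Fin (P.L ^ k)) ≃ {x // x ∈ iterBlock k y} where
  toFun j := ⟨blockSiteK k y j, blockSiteK_mem_iterBlock hk y j⟩
  invFun x := fun μ => ⟨(x.1 μ).val % P.L ^ k, Nat.mod_lt _ (pow_pos P.L_pos k)⟩
  left_inv j := by
    funext μ
    apply Fin.ext
    show ((blockSiteK k y j) μ).val % P.L ^ k = (j μ : ℕ)
    rw [val_blockSiteK hk, Nat.mul_add_mod', Nat.mod_eq_of_lt (j μ).isLt]
  right_inv x := by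
    obtain ⟨x, hx⟩ := x
    apply Subtype.ext
    funext μ
    apply ZMod.val_injective
    rw [val_blockSiteK hk]
    have h1 : (x μ).val / P.L ^ k = (y μ).val := (mem_iterBlock_iff hk y x).1 hx μ
    have h2 := Nat.div_add_mod ((x μ).val) (P.L ^ k)
    rw [h1] at h2
    simp only
    linarith [h2, mul_comm ((y μ).val) (P.L ^ k)]

/-- «Σ_{x∈B^k(y)}» as a sum over offsets. [cite: Balaban1984PropagatorsI, (1.18) p.20] -/
theorem sum_iterBlock_eq (hk : k ≤ P.m + P.K) {M : Type*} [AddCommMonoid M] (y : Site P k) (g : Site P 0 → M) :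
    ∑ x ∈ iterBlock k y, g x = ∑ j : Fin P.d → Fin (P.L ^ k), g (blockSiteK k y j) := by
  rw [← Finset.sum_coe_sort]
  exact (Fintype.sum_equiv (blockEquivK hk y) (fun j => g (blockSiteK k y j)) (fun x => g x) fun j => rfl).symm

/-- the straight contours «[x, x(b)]» of `L^k` bonds in (1.18), in both labellings: `EK (blockSiteK y j + t e_μ) = bpt y j + tstep μ t`.
[cite: Balaban1984PropagatorsI, (1.18) p.20] -/
theorem EK_runSite_blockSiteK (hk : k ≤ P.m + P.K) (y : Site P k) (j : Fin P.d → Fin (P.L ^ k)) (μ : Fin P.d) (t : ℕ) :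
    EK hk (runSite (blockSiteK k y j) μ t) = bpt (P.L ^ k) (Mk P k) y j + tstep (fine (P.L ^ k) (Mk P k)) μ t := by
  have h1 : runSite (blockSiteK k y j) μ t =
      fun ν => (((y ν).val * P.L ^ k + j ν + if ν = μ then t else 0 : ℕ) : ZMod (P.sitesPerDir 0)) := by
    funext ν
    by_cases hν : ν = μ
    · subst hν
      simp only [runSite, Function.update_self, blockSiteK, if_true]
      push_cast
      ring
    · simp only [runSite, Function.update_of_ne hν, blockSiteK, if_neg hν, add_zero]
  have h2 : bpt (P.L ^ k) (Mk P k) y j + tstep (fine (P.L ^ k) (Mk P k)) μ t =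
      fun ν => (((y ν).val * P.L ^ k + j ν + if ν = μ then t else 0 : ℕ) : ZMod (fine (P.L ^ k) (Mk P k) ν)) := by
    funext ν
    rw [Pi.add_apply, B5Blocks16.bpt_eq_natCast]
    by_cases hν : ν = μ
    · subst hν
      simp only [tstep, if_true]
      push_cast
      ring
    · simp only [tstep, if_neg hν, add_zero]
      push_cast
      ring
  rw [h1, EK_natCast, h2]

/-- the blocks correspond: `EK (blockSiteK y j) = bpt (L^k) Mk y j`. [cite: Balaban1984PropagatorsI, (1.18) p.20] -/
theorem EK_blockSiteK (hk : k ≤ P.m + P.K) (y : Site P k) (j : Fin P.d → Fin (P.L ^ k)) :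
    EK hk (blockSiteK k y j) = bpt (P.L ^ k) (Mk P k) y j := by
  have h := EK_runSite_blockSiteK hk y j ⟨0, P.hd⟩ 0
  rwa [runSite_zero, B5Block118.tstep_zero, add_zero] at h

/-- bonds `⟨x, x + ηe_μ⟩ ↔ (x, μ)` of `T^{(0)}` reindexed along `eK`. [cite: Balaban1984PropagatorsI, (1.1) p.18] -/
def eBondK (hk : k ≤ P.m + P.K) : PBond P 0 ≃ Tor (towerM P.L (Mk P k) k) × Fin P.d :=
  bondEquiv.symm.trans ((eK hk).prodCongr (Equiv.refl _))

/-- `eBondK⁻¹ (x, μ) = ⟨eK⁻¹ x, μ⟩`. [cite: Balaban1984PropagatorsI, (1.1) p.18] -/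
theorem eBondK_symm_apply (hk : k ≤ P.m + P.K) (x : Tor (towerM P.L (Mk P k) k)) (μ : Fin P.d) :
    (eBondK hk).symm (x, μ) = ⟨(eK hk).symm x, μ⟩ := rfl

/-- **transport of the finest vector fields** `A_μ(x)`, `x ∈ T_η` (linear equivalence). [cite: Balaban1984PropagatorsI, (1.1) p.18] -/
def tV (hk : k ≤ P.m + P.K) : VecField P 0 ℝ ≃ₗ[ℝ] Fld (towerM P.L (Mk P k) k) :=
  (LinearEquiv.funCongrLeft ℝ ℝ (eBondK hk).symm).trans
    (WithLp.linearEquiv 2 ℝ (Tor (towerM P.L (Mk P k) k) × Fin P.d → ℝ)).symm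

/-- values of the transported field. [cite: Balaban1984PropagatorsI, (1.1) p.18] -/
theorem tV_apply (hk : k ≤ P.m + P.K) (A : VecField P 0 ℝ) (i : Tor (towerM P.L (Mk P k) k) × Fin P.d) :
    tV hk A i = A ((eBondK hk).symm i) := rfl

/-- values of the pulled-back field. [cite: Balaban1984PropagatorsI, (1.1) p.18] -/
theorem tV_symm_apply (hk : k ≤ P.m + P.K) (A' : Fld (towerM P.L (Mk P k) k)) (b : PBond P 0) :
    (tV hk).symm A' b = A' (eBondK hk b) := rfl

/-- **transport of the finest gauge functions** `λ(x)`, `x ∈ T_η`. [cite: Balaban1984PropagatorsI, (1.4) p.18] -/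
def tS (hk : k ≤ P.m + P.K) : SiteField P 0 ℝ ≃ₗ[ℝ] Scl (towerM P.L (Mk P k) k) :=
  (LinearEquiv.funCongrLeft ℝ ℝ (eK hk).symm).trans (WithLp.linearEquiv 2 ℝ (Tor (towerM P.L (Mk P k) k) → ℝ)).symm

/-- values of the transported gauge function. [cite: Balaban1984PropagatorsI, (1.4) p.18] -/
theorem tS_apply (hk : k ≤ P.m + P.K) (lam : SiteField P 0 ℝ) (x : Tor (towerM P.L (Mk P k) k)) :
    tS hk lam x = lam ((eK hk).symm x) := rfl

/-- **transport of the unit-lattice block fields** `B_b`, `b ⊂ T₁^{(k)}` (the same function, `Site P k` being `Tor (Mk P k)`).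
[cite: Balaban1984PropagatorsI, (1.17) p.20] -/
def tB : VecField P k ℝ ≃ₗ[ℝ] Fld (Mk P k) :=
  (LinearEquiv.funCongrLeft ℝ ℝ (bondEquiv (P := P) (j := k))).trans (WithLp.linearEquiv 2 ℝ (Tor (Mk P k) × Fin P.d → ℝ)).symm

/-- values of the transported block field. [cite: Balaban1984PropagatorsI, (1.17) p.20] -/
theorem tB_apply (B : VecField P k ℝ) (i : Tor (Mk P k) × Fin P.d) : tB B i = B ⟨i.1, i.2⟩ := rfl

/-- transport of the unit-lattice gauge functions `(Q′_kλ)(y)`, `y ∈ T₁^{(k)}` (the same function). [cite: Balaban1984PropagatorsI, (1.20) p.20] -/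
def tSc : SiteField P k ℝ ≃ₗ[ℝ] Scl (Mk P k) := (WithLp.linearEquiv 2 ℝ (Tor (Mk P k) → ℝ)).symm

/-- values. [cite: Balaban1984PropagatorsI, (1.20) p.20] -/
theorem tSc_apply (mu : SiteField P k ℝ) (y : Tor (Mk P k)) : tSc mu y = mu y := rfl

/-! ## §1  Dictionaries: `Q_k` (1.18), `Q′_k` (1.20), `∂` (1.4), `S^η` (1.3)/(1.17) agree across the identification -/

/-- `eK⁻¹ ∘ towerE⁻¹ = EK⁻¹`. [cite: Balaban1984PropagatorsI, (1.18) p.20] -/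
theorem eK_symm_towerE_symm (hk : k ≤ P.m + P.K) (z : Tor (fine (P.L ^ k) (Mk P k))) :
    (eK hk).symm ((towerE P.L (Mk P k) k).symm z) = (EK hk).symm z := rfl

/-- **(1.18) «(Q_kA)_b = Σ_{x∈B^k(b₋)} η^{d+1}A([x, x(b)])» is ONE operator**: the composite `Qk` of the B5 tower (p21's one-stroke
`cplx_Qk`) of the transported field = the transported V1 composite `bondAvgIter k` (p39's one-stroke `bondAvgIter_eq_blockSum`).
[cite: Balaban1984PropagatorsI, (1.18) p.20] -/
theorem Qk_tV (hk : k ≤ P.m + P.K) (A : VecField P 0 ℝ) :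
    Qk P.L (Mk P k) k (tV hk A) = tB (bondAvgIter k A) := by
  apply cplx_injective
  rw [cplx_Qk]
  funext ⟨y, μ⟩
  rw [B5Block118.QvOp_mulVec]
  simp only [B5Block118.lineSum, trC_apply', cplx, tV_apply, eBondK_symm_apply, eK_symm_towerE_symm, tB_apply]
  have hpt : ∀ (j : Fin P.d → Fin (P.L ^ k)) (t : ℕ),
      (EK hk).symm (bpt (P.L ^ k) (Mk P k) y j + tstep (fine (P.L ^ k) (Mk P k)) μ t)
        = runSite (blockSiteK k y j) μ t := by
    intro j t
    rw [Equiv.symm_apply_eq, EK_runSite_blockSiteK]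
  simp only [hpt]
  rw [bondAvgIter_eq_blockSum k hk A ⟨y, μ⟩, sum_iterBlock_eq hk]
  simp only [segSum, runBond, smul_eq_mul]
  push_cast
  congr 1
  · rw [one_div, ← pow_mul, ← pow_mul, mul_comm k]
  · refine Finset.sum_congr rfl fun j _ => ?_
    rw [Fin.sum_univ_eq_sum_range (fun t => ((A ⟨runSite (blockSiteK k y j) μ t, μ⟩ : ℝ) : ℂ)) (P.L ^ k)]

/-- **(1.20) «(Q′_kλ)(y) = Σ_{x∈B^k(y)} η^dλ(x)» is ONE operator**: `Qsk` (p21's `cplxS_Qsk`) of the transported gauge function = the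
transported V1 `siteAvgIter k` (p39's `siteAvgIter_eq_blockSum`). [cite: Balaban1984PropagatorsI, (1.20) p.20] -/
theorem Qsk_tS (hk : k ≤ P.m + P.K) (lam : SiteField P 0 ℝ) :
    Qsk P.L (Mk P k) k (tS hk lam) = tSc (siteAvgIter k lam) := by
  have hinj : Function.Injective (cplxS (N := Mk P k)) := by
    intro a b h; ext x; exact Complex.ofReal_injective (congrFun h x)
  apply hinj
  rw [cplxS_Qsk]
  funext y
  rw [B5Block118.QsOp_mulVec]
  simp only [B5TowerOneStroke.trS_apply', cplxS, tS_apply, eK_symm_towerE_symm, tSc_apply]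
  have hpt : ∀ j : Fin P.d → Fin (P.L ^ k), (EK hk).symm (bpt (P.L ^ k) (Mk P k) y j) = blockSiteK k y j := by
    intro j
    rw [Equiv.symm_apply_eq, EK_blockSiteK]
  simp only [hpt]
  rw [siteAvgIter_eq_blockSum k hk lam y, sum_iterBlock_eq hk]
  simp only [smul_eq_mul]
  push_cast
  rw [one_div, ← pow_mul, ← pow_mul, mul_comm k]

/-- **(1.4) on `T_η`**: `tV (∂^cλ) = Dgrad c (tS λ)`. [cite: Balaban1984PropagatorsI, (1.4) p.18] -/
theorem tV_grad (hk : k ≤ P.m + P.K) (c : ℝ) (lam : SiteField P 0 ℝ) :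
    tV hk (grad c lam) = B5HierGaugeTorus.Dgrad (towerM P.L (Mk P k) k) c (tS hk lam) := by
  ext ⟨x, μ⟩
  rw [tV_apply, B5HierGaugeTorus.Dgrad_apply, eBondK_symm_apply, tS_apply, tS_apply]
  have h : (eK hk).symm (x + unitVec (towerM P.L (Mk P k) k) μ) = ((eK hk).symm x).shift μ := by
    rw [Equiv.symm_apply_eq, eK_shift, Equiv.apply_symm_apply]
  simp only [grad, PBond.tgt, h, smul_eq_mul]

/-- (1.4) pulled back: `tV⁻¹(∂^cλ) = ∂^c(tS⁻¹λ)`. [cite: Balaban1984PropagatorsI, (1.4) p.18] -/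
theorem tV_symm_Dgrad (hk : k ≤ P.m + P.K) (c : ℝ) (l : Scl (towerM P.L (Mk P k) k)) :
    (tV hk).symm (B5HierGaugeTorus.Dgrad _ c l) = grad c ((tS hk).symm l) := by
  apply (tV hk).injective
  rw [tV_grad, LinearEquiv.apply_symm_apply, LinearEquiv.apply_symm_apply]

/-- **(1.3) on `T_η`**: the B5 files' `actionS` (factor `c`, weight `w`) of the transported, complexified field = V1's `curlAction w c`
(same plaquettes). [cite: Balaban1984PropagatorsI, (1.3) p.18] -/
theorem actionS_tV (hk : k ≤ P.m + P.K) (c w : ℝ) (A : VecField P 0 ℝ) :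
    B5Action121.actionS (towerM P.L (Mk P k) k) (c : ℂ) w (cplx (tV hk A)) = curlAction w c A := by
  have hF : ∀ (x : Site P 0) (μ ν : Fin P.d) (h : μ < ν),
      B5Action121.Fs (towerM P.L (Mk P k) k) (c : ℂ) (cplx (tV hk A)) μ ν (eK hk x)
        = ((curl c A ⟨x, μ, ν, h⟩ : ℝ) : ℂ) := by
    intro x μ ν h
    rw [B5Action121.Fs_apply]
    simp only [cplx, tV_apply, eBondK_symm_apply, ← eK_shift, Equiv.symm_apply_apply, curl, smul_eq_mul]
    push_cast
    ring
  unfold B5Action121.actionS curlAction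
  congr 1
  have hP : ∑ p : Plaq P 0, w * ‖curl c A p‖ ^ 2
      = ∑ x : Site P 0, ∑ μ : Fin P.d, ∑ ν : Fin P.d, if h : μ < ν then w * ‖curl c A ⟨x, μ, ν, h⟩‖ ^ 2 else 0 := by
    set F : Site P 0 × Fin P.d × Fin P.d → ℝ :=
      fun a => if h : a.2.1 < a.2.2 then w * ‖curl c A ⟨a.1, a.2.1, a.2.2, h⟩‖ ^ 2 else 0 with hFdef
    let e : {t : Site P 0 × Fin P.d × Fin P.d // t.2.1 < t.2.2} ≃ Plaq P 0 :=
      ⟨fun t => ⟨t.1.1, t.1.2.1, t.1.2.2, t.2⟩, fun p => ⟨(p.src, p.μ, p.ν), p.hμν⟩, fun _ => rfl, fun _ => rfl⟩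
    have h1 : ∑ p : Plaq P 0, w * ‖curl c A p‖ ^ 2 = ∑ t : {t : Site P 0 × Fin P.d × Fin P.d // t.2.1 < t.2.2}, F t.1 := by
      rw [← Equiv.sum_comp e]
      refine Fintype.sum_congr _ _ fun t => ?_
      simp only [hFdef, dif_pos t.2]
      rfl
    have h2 : ∑ t : {t : Site P 0 × Fin P.d × Fin P.d // t.2.1 < t.2.2}, F t.1 = ∑ a, F a := by
      rw [← Finset.sum_subtype (Finset.univ.filter fun t : Site P 0 × Fin P.d × Fin P.d => t.2.1 < t.2.2)
        (fun t => by simp) F, Finset.sum_filter]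
      refine Finset.sum_congr rfl fun a _ => ?_
      by_cases h : a.2.1 < a.2.2
      · rw [if_pos h]
      · rw [if_neg h, hFdef]
        simp only [dif_neg h]
    rw [h1, h2, Fintype.sum_prod_type]
    exact Finset.sum_congr rfl fun x _ => Fintype.sum_prod_type _
  rw [hP, ← Equiv.sum_comp (eK hk)]
  refine Finset.sum_congr rfl fun x _ => Finset.sum_congr rfl fun μ _ => Finset.sum_congr rfl fun ν _ => ?_
  by_cases h : μ < ν
  · rw [if_pos h, dif_pos h, hF x μ ν h, Complex.norm_real]
  · rw [if_neg h, dif_neg h]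

/-- **«S^η(A)» of (1.17) is ONE functional**: `actionEta L Mk k (tV A) = curlAction (η^d) (L^k) A` (`η = L^{−k}`: weight `η^d`,
lattice factor `η⁻¹ = L^k`). [cite: Balaban1984PropagatorsI, (1.17) p.20] -/
theorem actionEta_tV (hk : k ≤ P.m + P.K) (A : VecField P 0 ℝ) :
    actionEta P.L (Mk P k) k (tV hk A) = curlAction (eta P.L k ^ P.d) ((P.L : ℝ) ^ k) A := by
  rw [actionEta, ← actionS_tV hk]
  push_cast
  rfl

/-! ## §2  The V1 hierarchical-axial subspace is a slice of the tower's residual orbit `∂N(Q′_k)`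

«The δ-function δ(B − Q_kA) is invariant with respect to gauge transformations λ satisfying Q′_kλ = 0 and we can look at the integral
(1.17) as obtained by removing this gauge freedom by the help of the δ-functions δ_Ax» (p. 20) — for EITHER choice of the block trees. -/

/-- the support of «δ_Ax(Q_{k−1}A)·…·δ_Ax(A)» on V1 (`BIJ85AxialPropagator411.deltaAx k`: all averages `Q_jA`, `j < k`, in the
CENTRED block-axial gauge), as a submodule. [cite: Balaban1984PropagatorsI, (1.17) p.20] -/
def axialAllV1 (P : Params) (k : ℕ) : Submodule ℝ (VecField P 0 ℝ) where
  carrier := {A | deltaAx k A}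
  zero_mem' := fun j _ => by rw [bondAvgIter_map_zero]; exact isAxial_zero
  add_mem' := by
    intro A B hA hB j hj
    rw [bondAvgIter_add]
    exact isAxial_add (hA j hj) (hB j hj)
  smul_mem' := by
    intro a A hA j hj
    rw [bondAvgIter_smul]
    exact isAxial_smul a (hA j hj)

/-- membership. [cite: Balaban1984PropagatorsI, (1.17) p.20] -/
theorem mem_axialAllV1_iff (A : VecField P 0 ℝ) : A ∈ axialAllV1 P k ↔ deltaAx k A := Iff.rfl

/-- `Q′_k` (composite) as a linear map. [cite: Balaban1984PropagatorsI, (1.20) p.20] -/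
def siteAvgIterL (P : Params) (k : ℕ) : SiteField P 0 ℝ →ₗ[ℝ] SiteField P k ℝ where
  toFun := siteAvgIter k
  map_add' := siteAvgIter_add k
  map_smul' := siteAvgIter_smul k

/-- the residual gauge orbit «gauge transformations λ satisfying Q′_kλ = 0» on V1: `{∂λ : Q′_kλ = 0}` (lattice factor `1`; the subspace
does not depend on a nonzero factor). [cite: Balaban1984PropagatorsI, (1.20) p.20] -/
def orbitV1K (P : Params) (k : ℕ) : Submodule ℝ (VecField P 0 ℝ) :=
  (LinearMap.ker (siteAvgIterL P k)).map (gradL (P := P) (j := 0) 1)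

/-- membership. [cite: Balaban1984PropagatorsI, (1.20) p.20] -/
theorem mem_orbitV1K_iff (A : VecField P 0 ℝ) :
    A ∈ orbitV1K P k ↔ ∃ lam : SiteField P 0 ℝ, siteAvgIter k lam = 0 ∧ grad 1 lam = A := by
  simp only [orbitV1K, Submodule.mem_map, LinearMap.mem_ker]
  rfl

/-- **`VecField P 0 = {δ_{k,Ax}} ⊕ ∂N(Q′_k)` on V1** — the hierarchical centred-axial conditions are a complete and unambiguous gauge
fixing of the residual group (p37's `B5HierAxialGaugeV1.hierAxial_exists` / `kernel_trivial`, read as a direct sum).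
[cite: Balaban1984PropagatorsI, (1.17) p.20, (1.23) p.21] -/
theorem isCompl_axialAllV1_orbitV1K (hk : k ≤ P.m + P.K) : IsCompl (axialAllV1 P k) (orbitV1K P k) := by
  refine IsCompl.of_eq ?_ ?_
  · rw [Submodule.eq_bot_iff]
    intro A hA
    obtain ⟨hAx, hO⟩ := Submodule.mem_inf.1 hA
    obtain ⟨lam, hlam, rfl⟩ := (mem_orbitV1K_iff A).1 hO
    have h0 : lam = 0 := B5HierAxialGaugeV1.kernel_trivial hk one_ne_zero hlam hAx
    rw [h0]
    funext b
    simp only [grad, Pi.zero_apply, sub_self, smul_zero]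
  · rw [Submodule.eq_top_iff']
    intro A
    obtain ⟨lam, hlam, hax⟩ := B5HierAxialGaugeV1.hierAxial_exists hk one_ne_zero A
    refine Submodule.mem_sup.2 ⟨gaugeShift 1 lam A, hax, grad 1 lam, (mem_orbitV1K_iff _).2 ⟨lam, hlam, rfl⟩, ?_⟩
    funext b
    simp only [gaugeShift, Pi.add_apply, sub_add_cancel]

/-- the hierarchical CENTRED-axial subspace of V1 carried to level `k` of the tower along `tV` — a second `δ_{k,Ax}`-type gauge there,
different from the owner's `AxAll k` (other block trees). [cite: Balaban1984PropagatorsI, (1.17) p.20] -/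
def axTK (hk : k ≤ P.m + P.K) : Submodule ℝ (Fld (towerM P.L (Mk P k) k)) :=
  (axialAllV1 P k).map ((tV hk : VecField P 0 ℝ ≃ₗ[ℝ] Fld (towerM P.L (Mk P k) k)) : VecField P 0 ℝ →ₗ[ℝ] _)

/-- membership: `A′ ∈ axTK ↔ δ_{k,Ax}(tV⁻¹A′)` (V1 sense). [cite: Balaban1984PropagatorsI, (1.17) p.20] -/
theorem mem_axTK_iff (hk : k ≤ P.m + P.K) (A' : Fld (towerM P.L (Mk P k) k)) :
    A' ∈ axTK hk ↔ deltaAx k ((tV hk).symm A') :=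
  Submodule.mem_map_equiv (axialAllV1 P k) (e := tV hk)

/-- `B5HierGaugeTorus.Dg L M k` is `Dgrad` with the lattice factor `L^k = η⁻¹`. [cite: Balaban1984PropagatorsI, (1.20) p.20] -/
theorem Dg_apply_eq (l : Scl (towerM P.L (Mk P k) k)) :
    B5HierGaugeTorus.Dg P.L (Mk P k) k l = B5HierGaugeTorus.Dgrad (towerM P.L (Mk P k) k) ((P.L : ℝ) ^ k) l := rfl

/-- **the two residual orbits coincide**: `tV` maps `{∂λ : Q′_kλ = 0}` of V1 onto the tower's `B5Eq147Landau.orbit L Mk k = ∂N(Q′_k)`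
(dictionaries (1.4) `tV_grad` and (1.20) `Qsk_tS`). [cite: Balaban1984PropagatorsI, (1.20) p.20] -/
theorem map_tV_orbitV1K (hk : k ≤ P.m + P.K) :
    (orbitV1K P k).map ((tV hk : VecField P 0 ℝ ≃ₗ[ℝ] Fld (towerM P.L (Mk P k) k)) : VecField P 0 ℝ →ₗ[ℝ] _)
      = B5Eq147Landau.orbit P.L (Mk P k) k := by
  have hL : ((P.L : ℝ) ^ k) ≠ 0 := pow_ne_zero _ (Nat.cast_ne_zero.2 P.L_pos.ne')
  ext A'
  rw [Submodule.mem_map_equiv, mem_orbitV1K_iff, B5Eq147Landau.mem_orbit_iff]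
  constructor
  · rintro ⟨lam, hlam, hA⟩
    refine ⟨tS hk (((P.L : ℝ) ^ k)⁻¹ • lam), ?_, ?_⟩
    · rw [map_smul, map_smul, Qsk_tS, hlam, map_zero, smul_zero]
    · rw [Dg_apply_eq, ← tV_grad, grad_smul, ← grad_mul, inv_mul_cancel₀ hL, hA, LinearEquiv.apply_symm_apply]
  · rintro ⟨l, hl, hA⟩
    refine ⟨(P.L : ℝ) ^ k • (tS hk).symm l, ?_, ?_⟩
    · have h := Qsk_tS hk ((tS hk).symm l)
      rw [LinearEquiv.apply_symm_apply, hl] at h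
      rw [siteAvgIter_smul, (LinearEquiv.map_eq_zero_iff _).1 h.symm, smul_zero]
    · rw [grad_smul, ← grad_mul, mul_one, ← tV_symm_Dgrad, ← hA]
      rfl

/-- **the transported hierarchical centred-axial subspace is a second slice of the tower's residual orbit**:
`Fld (towerM L Mk k) = axTK ⊕ ∂N(Q′_k)`. [cite: Balaban1984PropagatorsI, (1.17) p.20, (1.23) p.21] -/
theorem isCompl_axTK_orbit (hk : k ≤ P.m + P.K) : IsCompl (axTK hk) (B5Eq147Landau.orbit P.L (Mk P k) k) := by
  have h := (Submodule.orderIsoMapComap (tV hk)).isCompl (isCompl_axialAllV1_orbitV1K hk)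
  rw [← map_tV_orbitV1K hk]
  exact h

end

end B5Eq117TorusCarriers

end Literature.MathematicalPhysics.QuantumFieldTheory.Balaban1983to89
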